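import Mathlib

/-!
# Route `FordMaynardSieveConst01651`, target `SieveConst01651` (stmt-Parity-19185), line `sieve_decomposition`:
# helpers towards `stub_typeIIRegion` — the greedy block decomposition behind Ford–Maynard's "splittable"
# functions (arXiv:2407.14368v1, (7.12) `(eq:diprimes)`, Definition 7.15, Lemma 7.17)

Ford–Maynard decompose a smooth integer `d = q₁ ⋯ q_r` (primes listed in decreasing order) CANONICALLY as
`d = d₁ ⋯ d_s` "by successively adding the largest unused prime to `d_j` until the product is `> L` or we run out
of primes": the blocks are consecutive segments of the list, every block `b` has `b / P⁻(b) ≤ L` (the segment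
without its last element has product `≤ L`), and every block but the last has product `> L`.  Lemma 7.17
("splitting up smooth numbers") re-indexes `∑_d f(d) α_{d,m}` over these block tuples, which requires EXISTENCE and
UNIQUENESS of the decomposition; the two ordering/size conditions are then separated by Lemma 7.9.

This file proves the purely combinatorial core, for an arbitrary list `l` of positive integers (no primality or
sortedness is needed for existence/uniqueness) and a real threshold `L ≥ 1`; a segmentation is a list of blocks
`B : List (List ℕ)` with `B.flatten = l`:

* `greedyBlocks_exists` — a segmentation into nonempty blocks with `(b.dropLast).prod ≤ L` for every block and
  `L < b.prod` for every block except the last EXISTS;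
* `greedyBlocks_unique` — it is UNIQUE (two such segmentations of the same list coincide);
* `greedyBlocks_existsUnique` — packaged as `∃!`;
* `greedyBlocks_prod_le` — every block satisfies `b.prod ≤ L · (last element of b)` (the printed
  `d_j ∈ (L, P⁻(d_j) L]`, `d_s ∈ (1, P⁻(d_s) L]` when the list is the decreasing list of primes);
* `greedyBlocks_pow_le_prod` — `L^{s-1} ≤ l.prod` (so `s ≤ 1 + log d / log L`, the printed `s ≤ 1 + 3/σ`).

Def-free (the segmentation is characterised, not named). Nothing here proves anything about the Parity summit;
helpers for the Type-II region stub of one leaf.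
-/

namespace Summit.Parity.GeneralizedHardyLittlewood.FordMaynardSieveConst01651SieveConst01651

/-- A list of positive naturals has product `≥ 1`. [folklore] -/
theorem one_le_prod_of_forall_one_le {l : List ℕ} (h : ∀ a ∈ l, 1 ≤ a) : 1 ≤ l.prod := by
  induction l with
  | nil => simp
  | cons a l ih =>
    rw [List.prod_cons]
    exact Nat.mul_pos (h a List.mem_cons_self) (ih fun b hb => h b (List.mem_cons_of_mem a hb))

/-- Prefix products of a list of positive naturals are monotone. [folklore] -/
theorem prod_take_mono {l : List ℕ} (h : ∀ a ∈ l, 1 ≤ a) {i j : ℕ} (hij : i ≤ j) :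
    (l.take i).prod ≤ (l.take j).prod := by
  obtain ⟨k, rfl⟩ := Nat.exists_eq_add_of_le hij
  rw [List.take_add, List.prod_append]
  exact Nat.le_mul_of_pos_right _ (one_le_prod_of_forall_one_le fun a ha =>
    h a (List.mem_of_mem_drop (List.mem_of_mem_take ha)))

/-- **Existence of the greedy segmentation** ("successively adding the largest unused prime until the product is
`> L` or we run out of primes"). [cite: FordMaynard2024PrimeSieves, (7.12) and the paragraph before Definition 7.15] -/
theorem greedyBlocks_exists {L : ℝ} (hL : 1 ≤ L) :
    ∀ l : List ℕ, (∀ a ∈ l, 1 ≤ a) →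
      ∃ B : List (List ℕ), B.flatten = l ∧ (∀ b ∈ B, b ≠ []) ∧
        (∀ b ∈ B, (((b.dropLast).prod : ℕ) : ℝ) ≤ L) ∧ (∀ b ∈ B.dropLast, L < ((b.prod : ℕ) : ℝ)) := by
  classical
  suffices H : ∀ n : ℕ, ∀ l : List ℕ, l.length ≤ n → (∀ a ∈ l, 1 ≤ a) →
      ∃ B : List (List ℕ), B.flatten = l ∧ (∀ b ∈ B, b ≠ []) ∧
        (∀ b ∈ B, (((b.dropLast).prod : ℕ) : ℝ) ≤ L) ∧ (∀ b ∈ B.dropLast, L < ((b.prod : ℕ) : ℝ)) from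
    fun l hl => H l.length l le_rfl hl
  intro n
  induction n with
  | zero =>
    intro l hlen _
    have : l = [] := List.eq_nil_of_length_eq_zero (Nat.le_zero.mp hlen)
    subst this
    exact ⟨[], by simp, by simp, by simp, by simp⟩
  | succ n ih =>
    intro l hlen hl
    by_cases hnil : l = []
    · subst hnil
      exact ⟨[], by simp, by simp, by simp, by simp⟩
    by_cases hex : ∃ t : ℕ, t ≤ l.length ∧ L < (((l.take t).prod : ℕ) : ℝ)
    · -- cut the shortest prefix with product `> L`, recurse on the rest
      set t₀ := Nat.find hex with ht₀def
      have ht₀ : t₀ ≤ l.length ∧ L < (((l.take t₀).prod : ℕ) : ℝ) := Nat.find_spec hex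
      have hmin : ∀ t, t < t₀ → (((l.take t).prod : ℕ) : ℝ) ≤ L := by
        intro t ht
        have := Nat.find_min hex (ht₀def ▸ ht)
        push Not at this
        exact this (le_trans ht.le ht₀.1)
      have ht₀pos : 1 ≤ t₀ := by
        by_contra h0
        have : t₀ = 0 := by omega
        have h1 := ht₀.2
        rw [this, List.take_zero, List.prod_nil, Nat.cast_one] at h1
        linarith
      obtain ⟨B', hB'flat, hB'ne, hB'drop, hB'last⟩ := ih (l.drop t₀)
        (by rw [List.length_drop]; omega) (fun a ha => hl a (List.mem_of_mem_drop ha))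
      refine ⟨l.take t₀ :: B', ?_, ?_, ?_, ?_⟩
      · rw [List.flatten_cons, hB'flat, List.take_append_drop]
      · intro b hb
        rcases List.mem_cons.mp hb with rfl | hb
        · rw [Ne, List.take_eq_nil_iff]; push Not; exact ⟨by omega, hnil⟩
        · exact hB'ne b hb
      · intro b hb
        rcases List.mem_cons.mp hb with rfl | hb
        · rw [List.dropLast_eq_take, List.length_take, min_eq_left ht₀.1, List.take_take,
            min_eq_left (Nat.sub_le t₀ 1)]
          exact hmin _ (by omega)
        · exact hB'drop b hb
      · intro b hb
        by_cases hB'nil : B' = []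
        · rw [hB'nil] at hb; simp at hb
        · rw [List.dropLast_cons_of_ne_nil hB'nil] at hb
          rcases List.mem_cons.mp hb with rfl | hb
          · exact ht₀.2
          · exact hB'last b hb
    · -- no prefix exceeds `L`: one block
      push Not at hex
      refine ⟨[l], by simp, by simpa using hnil, ?_, by simp⟩
      intro b hb
      rw [List.mem_singleton] at hb
      subst hb
      rw [List.dropLast_eq_take]
      exact hex _ (Nat.sub_le _ _)

/-- The comparison step of uniqueness: two admissible first blocks of the same list cannot have different lengths.
[cite: FordMaynard2024PrimeSieves, (7.12) ("can be decomposed uniquely")] -/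
theorem greedyBlocks_first_aux {L : ℝ} {b₁ R₁ b₂ R₂ : List ℕ} (h : b₁ ++ R₁ = b₂ ++ R₂)
    (hlt : b₁.length < b₂.length) (hpos : ∀ a ∈ b₂, 1 ≤ a)
    (h2 : (((b₂.dropLast).prod : ℕ) : ℝ) ≤ L) (h1 : R₁ ≠ [] → L < ((b₁.prod : ℕ) : ℝ)) : False := by
  by_cases hR : R₁ = []
  · rw [hR, List.append_nil] at h
    have : b₁.length = b₂.length + R₂.length := by rw [h, List.length_append]
    omega
  · have hL := h1 hR
    have hb₁ : b₁ = b₂.take b₁.length := by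
      have e : (b₁ ++ R₁).take b₁.length = (b₂ ++ R₂).take b₁.length := by rw [h]
      rwa [List.take_append_of_le_length le_rfl, List.take_of_length_le le_rfl,
        List.take_append_of_le_length hlt.le] at e
    have hle : (b₂.take b₁.length).prod ≤ (b₂.dropLast).prod := by
      rw [List.dropLast_eq_take]
      exact prod_take_mono hpos (by omega)
    have : ((b₁.prod : ℕ) : ℝ) ≤ (((b₂.dropLast).prod : ℕ) : ℝ) := by
      rw [hb₁]; exact_mod_cast hle
    linarith

/-- **Uniqueness of the greedy segmentation.** [cite: FordMaynard2024PrimeSieves, (7.12) ("can be decomposed uniquely")] -/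
theorem greedyBlocks_unique {L : ℝ} :
    ∀ B₁ B₂ : List (List ℕ), (∀ a ∈ B₁.flatten, 1 ≤ a) → B₁.flatten = B₂.flatten →
      (∀ b ∈ B₁, b ≠ []) → (∀ b ∈ B₁, (((b.dropLast).prod : ℕ) : ℝ) ≤ L) →
        (∀ b ∈ B₁.dropLast, L < ((b.prod : ℕ) : ℝ)) →
      (∀ b ∈ B₂, b ≠ []) → (∀ b ∈ B₂, (((b.dropLast).prod : ℕ) : ℝ) ≤ L) →
        (∀ b ∈ B₂.dropLast, L < ((b.prod : ℕ) : ℝ)) → B₁ = B₂ := by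
  intro B₁
  induction B₁ with
  | nil =>
    intro B₂ _ hflat _ _ _ hne₂ _ _
    cases B₂ with
    | nil => rfl
    | cons b B =>
      exfalso
      have hb : b ≠ [] := hne₂ b List.mem_cons_self
      rw [List.flatten_nil, List.flatten_cons] at hflat
      exact hb (List.append_eq_nil_iff.mp hflat.symm).1
  | cons b₁ B₁' ih =>
    intro B₂ hpos hflat hne₁ hdrop₁ hlast₁ hne₂ hdrop₂ hlast₂
    cases B₂ with
    | nil =>
      exfalso
      have hb : b₁ ≠ [] := hne₁ b₁ List.mem_cons_self
      rw [List.flatten_nil, List.flatten_cons] at hflat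
      exact hb (List.append_eq_nil_iff.mp hflat).1
    | cons b₂ B₂' =>
      rw [List.flatten_cons, List.flatten_cons] at hflat
      -- the last-block conditions for the heads
      have h1 : B₁'.flatten ≠ [] → L < ((b₁.prod : ℕ) : ℝ) := by
        intro hR
        have hB : B₁' ≠ [] := by rintro rfl; exact hR rfl
        exact hlast₁ b₁ (by rw [List.dropLast_cons_of_ne_nil hB]; exact List.mem_cons_self)
      have h2 : B₂'.flatten ≠ [] → L < ((b₂.prod : ℕ) : ℝ) := by
        intro hR
        have hB : B₂' ≠ [] := by rintro rfl; exact hR rfl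
        exact hlast₂ b₂ (by rw [List.dropLast_cons_of_ne_nil hB]; exact List.mem_cons_self)
      have hposb₂ : ∀ a ∈ b₂, 1 ≤ a := fun a ha =>
        hpos a (by rw [List.flatten_cons, hflat]; exact List.mem_append_left _ ha)
      have hposb₁ : ∀ a ∈ b₁, 1 ≤ a := fun a ha =>
        hpos a (by rw [List.flatten_cons]; exact List.mem_append_left _ ha)
      -- equal lengths of the heads
      have hlen : b₁.length = b₂.length := by
        rcases lt_trichotomy b₁.length b₂.length with hlt | heq | hgt
        · exact (greedyBlocks_first_aux hflat hlt hposb₂ (hdrop₂ b₂ List.mem_cons_self) h1).elim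
        · exact heq
        · exact (greedyBlocks_first_aux hflat.symm hgt hposb₁ (hdrop₁ b₁ List.mem_cons_self) h2).elim
      have hb : b₁ = b₂ := by
        have e1 : (b₁ ++ B₁'.flatten).take b₁.length = b₁ := by
          rw [List.take_append_of_le_length le_rfl, List.take_of_length_le le_rfl]
        have e2 : (b₂ ++ B₂'.flatten).take b₂.length = b₂ := by
          rw [List.take_append_of_le_length le_rfl, List.take_of_length_le le_rfl]
        rw [← e1, hflat, hlen, e2]
      subst hb
      have hrest : B₁'.flatten = B₂'.flatten := List.append_cancel_left hflat
      have hsub : ∀ {B : List (List ℕ)}, ∀ b ∈ B.dropLast, b ∈ (b₁ :: B).dropLast := by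
        intro B b hb
        by_cases hB : B = []
        · rw [hB] at hb; simp at hb
        · rw [List.dropLast_cons_of_ne_nil hB]; exact List.mem_cons_of_mem _ hb
      rw [ih B₂' (fun a ha => hpos a (by rw [List.flatten_cons]; exact List.mem_append_right _ ha)) hrest
        (fun b hb => hne₁ b (List.mem_cons_of_mem _ hb)) (fun b hb => hdrop₁ b (List.mem_cons_of_mem _ hb))
        (fun b hb => hlast₁ b (hsub b hb))
        (fun b hb => hne₂ b (List.mem_cons_of_mem _ hb)) (fun b hb => hdrop₂ b (List.mem_cons_of_mem _ hb))
        (fun b hb => hlast₂ b (hsub b hb))]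

/-- **The greedy segmentation exists and is unique.** [cite: FordMaynard2024PrimeSieves, (7.12)] -/
theorem greedyBlocks_existsUnique {L : ℝ} (hL : 1 ≤ L) (l : List ℕ) (hl : ∀ a ∈ l, 1 ≤ a) :
    ∃! B : List (List ℕ), B.flatten = l ∧ (∀ b ∈ B, b ≠ []) ∧
      (∀ b ∈ B, (((b.dropLast).prod : ℕ) : ℝ) ≤ L) ∧ (∀ b ∈ B.dropLast, L < ((b.prod : ℕ) : ℝ)) := by
  obtain ⟨B, hB⟩ := greedyBlocks_exists hL l hl
  refine ⟨B, hB, fun B' hB' => ?_⟩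
  exact greedyBlocks_unique B' B (by rw [hB'.1]; exact hl) (by rw [hB'.1, hB.1]) hB'.2.1 hB'.2.2.1 hB'.2.2.2
    hB.2.1 hB.2.2.1 hB.2.2.2

/-- Every block satisfies `b.prod ≤ L · (last element)`: the printed `d_j ≤ P⁻(d_j) L` when the list is the
decreasing list of prime factors. [cite: FordMaynard2024PrimeSieves, (7.12)] -/
theorem greedyBlocks_prod_le {L : ℝ} {b : List ℕ} (hb : b ≠ [])
    (hdrop : (((b.dropLast).prod : ℕ) : ℝ) ≤ L) :
    ((b.prod : ℕ) : ℝ) ≤ L * ((b.getLast hb : ℕ) : ℝ) := by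
  have : b.prod = (b.dropLast).prod * b.getLast hb := by
    conv_lhs => rw [← List.dropLast_append_getLast hb]
    rw [List.prod_append, List.prod_singleton]
  rw [this, Nat.cast_mul]
  exact mul_le_mul_of_nonneg_right hdrop (Nat.cast_nonneg _)

/-- A list of naturals each `> L ≥ 0` has product `≥ L^{length}`. [folklore] -/
theorem pow_length_le_prod {L : ℝ} (hL : 0 ≤ L) {M : List ℕ} (hM : ∀ m ∈ M, L < ((m : ℕ) : ℝ)) :
    L ^ M.length ≤ ((M.prod : ℕ) : ℝ) := by
  induction M with
  | nil => simp
  | cons m M ih =>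
    rw [List.length_cons, pow_succ, List.prod_cons, Nat.cast_mul, mul_comm]
    exact mul_le_mul (hM m List.mem_cons_self).le (ih fun m' hm' => hM m' (List.mem_cons_of_mem _ hm'))
      (pow_nonneg hL _) (Nat.cast_nonneg _)

/-- **Few blocks**: `L^{s-1} ≤ l.prod` for a segmentation with `s` blocks all but the last of product `> L`
(`L ≥ 0`, entries `≥ 1`) — the printed "since `d_i > L ≥ x^{σ/3}` for `i ≤ s - 1`, `s ≤ 1 + 3/σ`".
[cite: FordMaynard2024PrimeSieves, Lemma 7.17 (proof)] -/
theorem greedyBlocks_pow_le_prod {L : ℝ} (hL : 0 ≤ L) {B : List (List ℕ)} (hpos : ∀ a ∈ B.flatten, 1 ≤ a)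
    (hlast : ∀ b ∈ B.dropLast, L < ((b.prod : ℕ) : ℝ)) :
    L ^ (B.length - 1) ≤ ((B.flatten.prod : ℕ) : ℝ) := by
  by_cases hB : B = []
  · subst hB; simp
  · have hsplit : B = B.dropLast ++ [B.getLast hB] := (List.dropLast_append_getLast hB).symm
    have hflat : B.flatten.prod = (B.dropLast.map List.prod).prod * (B.getLast hB).prod := by
      conv_lhs => rw [hsplit]
      rw [List.flatten_append, List.prod_append, List.prod_flatten, List.flatten_singleton]
    have h1 : L ^ (B.length - 1) ≤ (((B.dropLast.map List.prod).prod : ℕ) : ℝ) := by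
      rw [← List.length_dropLast, ← List.length_map (f := List.prod)]
      refine pow_length_le_prod hL fun m hm => ?_
      obtain ⟨b, hb, rfl⟩ := List.mem_map.mp hm
      exact hlast b hb
    have h2 : 1 ≤ (B.getLast hB).prod :=
      one_le_prod_of_forall_one_le fun a ha => hpos a (List.mem_flatten.mpr ⟨_, List.getLast_mem hB, ha⟩)
    rw [hflat, Nat.cast_mul]
    calc L ^ (B.length - 1) ≤ (((B.dropLast.map List.prod).prod : ℕ) : ℝ) := h1
      _ = (((B.dropLast.map List.prod).prod : ℕ) : ℝ) * 1 := (mul_one _).symm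
      _ ≤ (((B.dropLast.map List.prod).prod : ℕ) : ℝ) * (((B.getLast hB).prod : ℕ) : ℝ) :=
          mul_le_mul_of_nonneg_left (by exact_mod_cast h2) (Nat.cast_nonneg _)

/-! ### Peeling criteria: when is `b :: B'` / `B' ++ [a]` the greedy segmentation? -/

/-- **First-block criterion.** `b :: B'` is an admissible segmentation (nonempty blocks, `dropLast.prod ≤ L`,
all-but-last `> L`) iff `b` is nonempty with `b.dropLast.prod ≤ L`, `B'` is admissible, and `L < b.prod` unless
`B'` is empty. (With uniqueness: the greedy blocks of `b ++ B'.flatten` are `b ::` the greedy blocks of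
`B'.flatten` exactly under these conditions — the form used when the FIRST block is peeled off as a variable.)
[cite: FordMaynard2024PrimeSieves, (7.12)] -/
theorem greedyBlocks_cons_iff {L : ℝ} (b : List ℕ) (B' : List (List ℕ)) :
    ((∀ c ∈ b :: B', c ≠ []) ∧ (∀ c ∈ b :: B', (((c.dropLast).prod : ℕ) : ℝ) ≤ L) ∧
        (∀ c ∈ (b :: B').dropLast, L < ((c.prod : ℕ) : ℝ))) ↔
      (b ≠ [] ∧ (((b.dropLast).prod : ℕ) : ℝ) ≤ L ∧ (B' ≠ [] → L < ((b.prod : ℕ) : ℝ)) ∧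
        (∀ c ∈ B', c ≠ []) ∧ (∀ c ∈ B', (((c.dropLast).prod : ℕ) : ℝ) ≤ L) ∧
        (∀ c ∈ B'.dropLast, L < ((c.prod : ℕ) : ℝ))) := by
  have hdl : ∀ c, c ∈ (b :: B').dropLast ↔ (B' ≠ [] ∧ c = b) ∨ c ∈ B'.dropLast := by
    intro c
    by_cases hB : B' = []
    · subst hB; simp
    · rw [List.dropLast_cons_of_ne_nil hB, List.mem_cons]
      constructor
      · rintro (rfl | h)
        · exact Or.inl ⟨hB, rfl⟩
        · exact Or.inr h
      · rintro (⟨_, rfl⟩ | h)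
        · exact Or.inl rfl
        · exact Or.inr h
  constructor
  · rintro ⟨hne, hdrop, hlast⟩
    refine ⟨hne b List.mem_cons_self, hdrop b List.mem_cons_self,
      fun hB => hlast b ((hdl b).mpr (Or.inl ⟨hB, rfl⟩)),
      fun c hc => hne c (List.mem_cons_of_mem _ hc), fun c hc => hdrop c (List.mem_cons_of_mem _ hc),
      fun c hc => hlast c ((hdl c).mpr (Or.inr hc))⟩
  · rintro ⟨hb, hbdrop, hblast, hne, hdrop, hlast⟩
    refine ⟨?_, ?_, ?_⟩
    · intro c hc
      rcases List.mem_cons.mp hc with rfl | hc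
      · exact hb
      · exact hne c hc
    · intro c hc
      rcases List.mem_cons.mp hc with rfl | hc
      · exact hbdrop
      · exact hdrop c hc
    · intro c hc
      rcases (hdl c).mp hc with ⟨hB, rfl⟩ | hc
      · exact hblast hB
      · exact hlast c hc

/-- **Last-block criterion.** `B' ++ [a]` is an admissible segmentation iff `a` is nonempty with
`a.dropLast.prod ≤ L` and EVERY block of `B'` is nonempty with `dropLast.prod ≤ L` and product `> L` (the last
block of `B'` included) — the form used when the LAST (smallest) block is peeled off as the short Type-II variable:
"`u = u₁ ⋯ u_s` with `u_j > x^{σ/3}` for `j < s` and `u_s ≤ x^{σ/3}`". [cite: FordMaynard2024PrimeSieves, (7.12),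
Lemma 7.17] -/
theorem greedyBlocks_concat_iff {L : ℝ} (B' : List (List ℕ)) (a : List ℕ) :
    ((∀ c ∈ B' ++ [a], c ≠ []) ∧ (∀ c ∈ B' ++ [a], (((c.dropLast).prod : ℕ) : ℝ) ≤ L) ∧
        (∀ c ∈ (B' ++ [a]).dropLast, L < ((c.prod : ℕ) : ℝ))) ↔
      (a ≠ [] ∧ (((a.dropLast).prod : ℕ) : ℝ) ≤ L ∧
        (∀ c ∈ B', c ≠ []) ∧ (∀ c ∈ B', (((c.dropLast).prod : ℕ) : ℝ) ≤ L) ∧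
        (∀ c ∈ B', L < ((c.prod : ℕ) : ℝ))) := by
  rw [List.dropLast_concat]
  simp only [List.mem_append, List.mem_singleton]
  constructor
  · rintro ⟨hne, hdrop, hlast⟩
    exact ⟨hne a (Or.inr rfl), hdrop a (Or.inr rfl), fun c hc => hne c (Or.inl hc),
      fun c hc => hdrop c (Or.inl hc), hlast⟩
  · rintro ⟨ha, hadrop, hne, hdrop, hlast⟩
    refine ⟨?_, ?_, hlast⟩
    · rintro c (hc | rfl)
      · exact hne c hc
      · exact ha
    · rintro c (hc | rfl)
      · exact hdrop c hc
      · exact hadrop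

/-- **Restriction.** The greedy blocks of a concatenation restrict: if `B₁ ++ B₂` is admissible then so is `B₁`
with, in addition, ALL its blocks `> L` when `B₂ ≠ []` (so, by uniqueness, the greedy segmentation of
`u' = u / u_s` is the one of `u` with the last block removed). [cite: FordMaynard2024PrimeSieves, (7.12)] -/
theorem greedyBlocks_restrict_left {L : ℝ} {B₁ B₂ : List (List ℕ)}
    (hne : ∀ c ∈ B₁ ++ B₂, c ≠ []) (hdrop : ∀ c ∈ B₁ ++ B₂, (((c.dropLast).prod : ℕ) : ℝ) ≤ L)
    (hlast : ∀ c ∈ (B₁ ++ B₂).dropLast, L < ((c.prod : ℕ) : ℝ)) :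
    (∀ c ∈ B₁, c ≠ []) ∧ (∀ c ∈ B₁, (((c.dropLast).prod : ℕ) : ℝ) ≤ L) ∧
      (∀ c ∈ B₁.dropLast, L < ((c.prod : ℕ) : ℝ)) ∧ (B₂ ≠ [] → ∀ c ∈ B₁, L < ((c.prod : ℕ) : ℝ)) := by
  refine ⟨fun c hc => hne c (List.mem_append_left _ hc), fun c hc => hdrop c (List.mem_append_left _ hc),
    fun c hc => hlast c ?_, fun hB₂ c hc => hlast c ?_⟩
  · by_cases hB₂ : B₂ = []
    · subst hB₂; simpa using hc
    · rw [List.dropLast_append_of_ne_nil hB₂]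
      exact List.mem_append_left _ (List.dropLast_subset _ hc)
  · rw [List.dropLast_append_of_ne_nil hB₂]
    exact List.mem_append_left _ hc

end Summit.Parity.GeneralizedHardyLittlewood.FordMaynardSieveConst01651SieveConst01651
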